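import Literature.NumberTheory.GelbartRogawski1991.LocalDoubledUnitaryParabolicNorm
import Literature.NumberTheory.Automorphic.TateLocalZetaShells
import Literature.NumberTheory.Automorphic.MatrixAdeleModule
import Literature.NumberTheory.Automorphic.UnitaryGroupBorelInduction
import Literature.NumberTheory.Automorphic.AdicCompletionCompact
import HarnessLib

/-!
# The module of a unit of `E ⊗_F F_v = Π_{w ∣ v} E_w` is the product of the normalised absolute values of its components;
# `‖u‖^{1/2} = Π_w √‖u_w‖_w`

Topic `NumberTheory/Automorphic`; namespace `Literature.NumberTheory.Automorphic.UnitaryGroup` (that of ★ `unitModulusChar`, ★ `halfModulusChar`,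
★ `LocalRing`).  KERNEL ONLY: theorems; no definition, no named fact, no instance, no notation, no `sorry`.  Cell `hodgecm-mathlib` (D-0151),
programme P2, N3 road (D3d): the SCALAR DICTIONARY between the parabolic normalisation's `Π_w √‖det_Δ p_w‖_w` (★ `parabolic_toRep_conj_localSplittingDatumCM`,
Mathlib's norm on `E_w`) and the exponent token `halfModulusChar (LocalRing L v)` of ★ `cmXiTorusChar` (Haar module of `Π_w E_w`), seat A-p16 (g24).

* §1 `distribHaarChar_eq_normAbs` — for a non-archimedean local field `K` and `a ∈ Kˣ`, Mathlib's Haar module `distribHaarChar K a` IS the normalised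
  absolute value `normAbs K a` (★ `addHaar_smul_set`: `μ(a𝒪) = |a| μ(𝒪)`, Tate's Lemma 2.2.5; Mathlib `distribHaarChar_eq_of_measure_smul_eq_mul`).
* §2 `unitModulusChar_localRing_eq_prod` — `‖u‖ = Π_{w ∣ v} |u_w|_w` for `u ∈ (Π_w E_w)ˣ` (★ `distribHaarChar_pi_units`: modules multiply on finite products);
  `coe_halfModulusChar_localRing_eq_prod` — `‖u‖^{1/2} = Π_w √‖u_w‖` with Mathlib's norm `‖·‖` on `E_w` (= `normAbs`, §0).
[WeilBNT1967, Ch. I §2 (modules of products); Tate1950, §2.2 Lemma 2.2.5; Rogawski1990, §12.2 p. 173 (`‖·‖_E`).]  HC_CM is proved only modulo the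
printed citations until rung 0 closes; count-neutral helper.

## References
* [Tate1950] J. Tate, *Fourier analysis in number fields and Hecke's zeta-functions* (1950), §2.2, Lemma 2.2.5.
* [WeilBNT1967] A. Weil, *Basic Number Theory* (1967), Ch. I §2.
* [Rogawski1990] J. D. Rogawski, Ann. of Math. Stud. 123 (1990), §12.2 p. 173.
-/

set_option autoImplicit false

noncomputable section

open NumberField IsDedekindDomain MeasureTheory
open scoped NNReal Pointwise
open Literature.NumberTheory.GaloisRepresentations Literature.NumberTheory.GaloisRepresentations.IsNonarchimedeanLocalField

namespace Literature.NumberTheory.Automorphic.UnitaryGroup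

/-! ## §0 Mathlib's norm on `E_w` is `normAbs` -/

section Bridge

variable (E : Type) [Field E] [NumberField E] (w : HeightOneSpectrum (𝓞 E))

/-- Mathlib's norm on `E_w` is the normalised absolute value `normAbs` of the local field `E_w` (= the tree's `norm_eq_coe_normAbs` of
`GlobalHeckeTheoryGL2OfCenterInvariant`, reproduced to keep the import closure small — as in ★ `LocalDoubledUnitaryParabolicNorm`). [folklore] -/
private theorem norm_eq_coe_normAbs' (x : w.adicCompletion E) : ‖x‖ = ((normAbs (w.adicCompletion E) x : ℝ≥0) : ℝ) := by
  by_cases hx : x = 0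
  · rw [hx, norm_zero, map_zero, NNReal.coe_zero]
  have hv : Valued.v x ≠ 0 := (Valuation.ne_zero_iff _).2 hx
  have hxn : Valued.v x = WithZero.exp (Multiplicative.toAdd (WithZero.unzero hv)) := by
    rw [WithZero.exp, ofAdd_toAdd, WithZero.coe_unzero]
  rw [FinitePlace.norm_def, WithZeroMulInt.toNNReal_neg_apply _ hv,
    normAbs_eq_inv_zpow_of_valued_eq w hxn, residueFieldCard_adicCompletion_eq, _root_.inv_zpow', neg_neg]
  rfl

end Bridge

/-! ## §1 The Haar module of a local field is its normalised absolute value -/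

section LocalField

variable (K : Type*) [Field K] [ValuativeRel K] [TopologicalSpace K] [IsNonarchimedeanLocalField K]

/-- **`distribHaarChar K a = |a|_K`**: multiplication by `a ∈ Kˣ` scales additive Haar measure on the non-archimedean local field `K` by the normalised
absolute value (evaluate on the compact open `𝒪_K = {v ≤ 1}`; ★ `addHaar_smul_set`). [cite: Tate1950, §2.2, Lemma 2.2.5] -/
theorem distribHaarChar_eq_normAbs (a : Kˣ) : distribHaarChar K a = normAbs K (a : K) := by
  borelize K
  -- a compact set with non-empty interior has positive finite Haar measure
  obtain ⟨S⟩ := (inferInstance : Nonempty (TopologicalSpace.PositiveCompacts K))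
  have hμ0 : Measure.addHaar (S : Set K) ≠ 0 := fun h0 =>
    (isOpen_interior.measure_ne_zero Measure.addHaar S.interior_nonempty) (measure_mono_null interior_subset h0)
  have hμt : Measure.addHaar (S : Set K) ≠ ⊤ := S.isCompact.measure_lt_top.ne
  refine distribHaarChar_eq_of_measure_smul_eq_mul (μ := Measure.addHaar) hμ0 hμt ?_
  exact addHaar_smul_set Measure.addHaar a.ne_zero (S : Set K)

end LocalField

/-! ## §2 The module of a unit of `Π_{w ∣ v} E_w` -/

section Product

variable {F : Type} (E : Type) [Field F] [NumberField F] [Field E] [NumberField E] [Algebra F E] (v : HeightOneSpectrum (𝓞 F))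

/-- **`‖u‖ = Π_{w ∣ v} |u_w|_w`** for a unit `u` of `E ⊗_F F_v = Π_{w ∣ v} E_w` (★ `unitModulusChar` = Mathlib `distribHaarChar`; modules multiply on
finite products ★ `distribHaarChar_pi_units`; each factor by §1). [cite: WeilBNT1967, Ch. I §2] [cite: Rogawski1990, §12.2 p. 173] -/
theorem unitModulusChar_localRing_eq_prod (u : (LocalRing E v)ˣ) :
    unitModulusChar (LocalRing E v) u = ∏ w : PlacesOver E v, normAbs (w.1.adicCompletion E) ((u : LocalRing E v) w) := by
  haveI : ∀ w : PlacesOver E v, SecondCountableTopology (w.1.adicCompletion E) := fun w => secondCountableTopology_localField _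
  unfold unitModulusChar
  rw [distribHaarChar_pi_units]
  exact Finset.prod_congr rfl fun w _ => distribHaarChar_eq_normAbs _ _

/-- **`‖u‖^{1/2} = Π_{w ∣ v} √‖u_w‖`** as a complex number (★ `halfModulusChar`; Mathlib's norm on `E_w` = `normAbs`, §0) — the exponent token of
★ `cmXiTorusChar` against the `√‖det_Δ‖` of ★ `parabolic_toRep_conj_localSplittingDatumCM`. [cite: Rogawski1990, §12.2 p. 173] [cite: Tate1950, §2.2, Lemma 2.2.5] -/
theorem coe_halfModulusChar_localRing_eq_prod (u : (LocalRing E v)ˣ) :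
    ((halfModulusChar (LocalRing E v) u : ℂˣ) : ℂ) = ((∏ w : PlacesOver E v, Real.sqrt ‖(u : LocalRing E v) w‖ : ℝ) : ℂ) := by
  rw [coe_halfModulusChar_apply, unitModulusChar_localRing_eq_prod]
  have hsq : NNReal.sqrt (∏ w : PlacesOver E v, normAbs (w.1.adicCompletion E) ((u : LocalRing E v) w)) =
      ∏ w : PlacesOver E v, NNReal.sqrt (normAbs (w.1.adicCompletion E) ((u : LocalRing E v) w)) := map_prod NNReal.sqrtHom _ _
  rw [hsq, NNReal.coe_prod]
  congr 1
  exact Finset.prod_congr rfl fun w _ => by rw [Real.coe_sqrt, norm_eq_coe_normAbs']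

end Product

end Literature.NumberTheory.Automorphic.UnitaryGroup

end
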